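import Summits.ResolutionOfSingularities.ResolutionOfSingularities.Theorems.HilbertSamuelEliminationSigmaMaxModificationsCorridor3SigmaMenuSurfacePointStep
import Literature.AlgebraicGeometry.Resolution.EmbeddedResolutionCurvesInSurfaces
import HarnessLib

/-!
# [OURS · L1 W4.2] σ-LAYER PHASE B′ — `Corridor3SigmaMenuSurfacePointStepF75`: the F-75c FEED of the point step — under the locus form of Stacks 0BIC
# (`Stacks0BIC_embeddedResolutionCurvesInSurfaces_locus`, Literature named fact F-75c, taken as a HYPOTHESIS) resolving compositions WITH CENTRES ON THE
# CONFIGURATION exist, so `ℓ` is meaningful: `0 < ℓ(E, D) ↔ S(E, D)` is not yet snc, and the POINT step SPEAKS on every regular, excellent, 2-dimensional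
# surface whose filtered trace configuration is nowhere dense and not snc
# (res-L1-w42-plan-1 RULING v3.14-36 (IC)/(IE), CRUX-PLAN w42 v3.13b (4); res-L1-w42-stub-1 DESIGN NOTE (d3) 15:21:25Z / res-lit-3 F-75c 15:31:09Z; crux chain w42
# `SigmaMaxModifications` stmt-ResolutionOfSingularities-18506 / conjunct `SigmaMaxModificationsCorridor3` stmt-ResolutionOfSingularities-19249; helper of
# res-L1-w42-stub-1 (gen 5), `--supports stmt-…-19249 --as helper`, counted 0)

HONEST FRAMING. OURS bookkeeping: one-line consequences of this seat's `…SigmaPointCompositionMinLength` / `…SigmaMenuSurfacePointStep` and the Literature named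
fact F-75c (statement only, CONSTRUCTION flag: the locus clause is proof text of Tags 0BIB/0AHH/0BIC) taken as the hypothesis `hF`, never asserted. NOTHING here
is a statement of H. Hironaka's manuscript [Hironaka2017] nor of [CossartJannsenSaito2020]. AI-written; AI review is weaker than expert review.

## Contents (namespace `…Theorems.SigmaMaxModificationsCorridor3.Sigma`)

* `exists_existsPointCompositionN_support_of_stacks0BIC_locus` — F-75c ⇒ `∃ n, ExistsPointCompositionN V(Z) (ResolvesToSnc V(Z)) n` (Noetherian, all local rings
  regular, excellent, `topologicalKrullDim = 2`, `V(Z)` nowhere dense); `exists_existsPointCompositionN_of_isClosed_of_stacks0BIC_locus` — the same for a CLOSED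
  nowhere dense `S` (through `Z := 𝓘(S)`).
* `sncLength_pos_iff_of_stacks0BIC_locus` — then `0 < sncLength S S ↔ ¬ IsStrictNormalCrossingsDivisor X S`.
* SURFACE READING: `surfaceSncLength_pos_iff_of_stacks0BIC_locus` (`0 < ℓ(E, D) ↔ S(E, D)` not snc on `D̃`) and **`exists_pointStepOfRecord_of_not_isSNC`** — on a
  Noetherian, regular, excellent, 2-dimensional `D̃ = (menuCentre D).subscheme` whose configuration `S(E, D)` is nowhere dense and NOT an snc divisor, the point
  step proposes a centre (non-vacuity of the third branch of o1's `SurfacePrep.ofRecord` modulo F-75c).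

VACUITY SELF-CHECK. Everything is conditional on `hF : Stacks0BIC_embeddedResolutionCurvesInSurfaces_locus` (formalisation debt in Literature, printed proof
Stacks 0BIC/0BIB) and on the listed hypotheses on `D̃`, which the (P1*) instance supplies (surface components of `X(ν)` in an excellent Noetherian threefold
stage, after PHASE S). No step is asserted unconditionally.
-/

noncomputable section

set_option linter.dupNamespace false -- mandated namespace of this single-conjunct summit

open CategoryTheory AlgebraicGeometry TopologicalSpace
open Summit.ResolutionOfSingularities.ResolutionOfSingularities.Theorems.CampaignW42
open Literature.AlgebraicGeometry.Resolution Literature.RingTheory.HilbertSamuel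

namespace Summit.ResolutionOfSingularities.ResolutionOfSingularities.Theorems.SigmaMaxModificationsCorridor3.Sigma

universe u

open Scheme.IdealSheafData

/-! ## F-75c ⇒ resolving compositions with centres on the configuration exist -/

/-- **F-75c feeds `ℓ_{V(Z)}`**: under the hypotheses of `Stacks0BIC_embeddedResolutionCurvesInSurfaces_locus` some composition of point blowing ups with all centres
over `V(Z)` resolves `V(Z)` to snc. [cite: StacksProject, Tag 0BIC (Lemma 54.15.6, proof)] -/
theorem exists_existsPointCompositionN_support_of_stacks0BIC_locus (hF : Stacks0BIC_embeddedResolutionCurvesInSurfaces_locus.{u}) (X : Scheme.{u})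
    [IsNoetherian X] (Z : X.IdealSheafData) (hreg : Scheme.IsRegular X) (hexc : Scheme.IsExcellent X) (hdim : topologicalKrullDim X = 2)
    (hZ : IsNowhereDense (Z.support : Set X)) : ∃ n, ExistsPointCompositionN (Z.support : Set X) (ResolvesToSnc (Z.support : Set X)) n := by
  obtain ⟨X', π, hπ, -, hsnc⟩ := hF X Z hreg hexc hdim hZ
  obtain ⟨n, hn⟩ := IsPointBlowupCompositionN.exists_length hπ
  exact ⟨n, X', π, hn, hsnc⟩

/-- **The same for a closed nowhere dense subset `S`** (through its reduced ideal sheaf `𝓘(S)`, whose support is `S`).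
[cite: StacksProject, Tag 0BIC (Lemma 54.15.6, proof)] -/
theorem exists_existsPointCompositionN_of_isClosed_of_stacks0BIC_locus (hF : Stacks0BIC_embeddedResolutionCurvesInSurfaces_locus.{u}) (X : Scheme.{u})
    [IsNoetherian X] (hreg : Scheme.IsRegular X) (hexc : Scheme.IsExcellent X) (hdim : topologicalKrullDim X = 2) {S : Set X} (hS : IsClosed S)
    (hnd : IsNowhereDense S) : ∃ n, ExistsPointCompositionN S (ResolvesToSnc S) n := by
  have hsupp : ((vanishingIdeal (⟨S, hS⟩ : Closeds X)).support : Set X) = S := Scheme.IdealSheafData.coe_support_vanishingIdeal ⟨S, hS⟩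
  have h := exists_existsPointCompositionN_support_of_stacks0BIC_locus hF X (vanishingIdeal ⟨S, hS⟩) hreg hexc hdim (by rw [hsupp]; exact hnd)
  rwa [hsupp] at h

/-- **F-75c ⇒ `0 < ℓ_S(X, S)` iff `S` is not yet snc.** [folklore] -/
theorem sncLength_pos_iff_of_stacks0BIC_locus (hF : Stacks0BIC_embeddedResolutionCurvesInSurfaces_locus.{u}) (X : Scheme.{u}) [IsNoetherian X]
    (hreg : Scheme.IsRegular X) (hexc : Scheme.IsExcellent X) (hdim : topologicalKrullDim X = 2) {S : Set X} (hS : IsClosed S) (hnd : IsNowhereDense S) :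
    0 < sncLength S S ↔ ¬ IsStrictNormalCrossingsDivisor X S := by
  rw [pos_iff_ne_zero, Ne, sncLength_eq_zero_iff (exists_existsPointCompositionN_of_isClosed_of_stacks0BIC_locus hF X hreg hexc hdim hS hnd)]

/-! ## Surface reading -/

variable {W : Scheme.{u}}

/-- The configuration `S(E, D)` is closed in `D̃` (a finite union of supports). [folklore] -/
theorem isClosed_surfaceTraceSet (E : Boundary W) (D : Closeds W) : IsClosed (surfaceTraceSet E D) :=
  Boundary.isClosed_divisorSet _

/-- **F-75c ⇒ `0 < ℓ(E, D)` iff the filtered trace configuration is not snc on `D̃`** (for `D̃` Noetherian, regular, excellent, 2-dimensional, `S(E, D)` nowhere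
dense). [folklore] -/
theorem surfaceSncLength_pos_iff_of_stacks0BIC_locus (hF : Stacks0BIC_embeddedResolutionCurvesInSurfaces_locus.{u}) (E : Boundary W) (D : Closeds W)
    [IsNoetherian (menuCentre D).subscheme] (hreg : Scheme.IsRegular (menuCentre D).subscheme) (hexc : Scheme.IsExcellent (menuCentre D).subscheme)
    (hdim : topologicalKrullDim ↥(menuCentre D).subscheme = 2) (hnd : IsNowhereDense (surfaceTraceSet E D)) :
    0 < surfaceSncLength E D ↔ ¬ IsStrictNormalCrossingsDivisor (menuCentre D).subscheme (surfaceTraceSet E D) :=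
  sncLength_pos_iff_of_stacks0BIC_locus hF _ hreg hexc hdim (isClosed_surfaceTraceSet E D) hnd

/-- **THE POINT STEP SPEAKS ON A NON-SNC CONFIGURATION (modulo F-75c).** On a Noetherian, regular, excellent, 2-dimensional reduced surface `D̃` whose filtered
trace configuration `S(E, D)` is nowhere dense and NOT a strict normal crossings divisor, the F-75 point step proposes some centre — the third branch of o1's
`SurfacePrep.ofRecord` is non-vacuous. [folklore] -/
theorem exists_pointStepOfRecord_of_not_isSNC (hF : Stacks0BIC_embeddedResolutionCurvesInSurfaces_locus.{u}) {hW : IsLocallyNoetherian W} {N : ℕ}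
    {ν : ℕ → ℕ} {L : Labelling W} {P : Option (Pending W)} (E : Boundary W) (D : Closeds W) [IsNoetherian (menuCentre D).subscheme]
    (hreg : Scheme.IsRegular (menuCentre D).subscheme) (hexc : Scheme.IsExcellent (menuCentre D).subscheme)
    (hdim : topologicalKrullDim ↥(menuCentre D).subscheme = 2) (hnd : IsNowhereDense (surfaceTraceSet E D))
    (hnot : ¬ IsStrictNormalCrossingsDivisor (menuCentre D).subscheme (surfaceTraceSet E D)) :
    ∃ C : W.IdealSheafData, pointStepOfRecord W hW N ν L P E D C :=
  exists_pointStepOfRecord_iff_pos.mpr ((surfaceSncLength_pos_iff_of_stacks0BIC_locus hF E D hreg hexc hdim hnd).mpr hnot)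

end Summit.ResolutionOfSingularities.ResolutionOfSingularities.Theorems.SigmaMaxModificationsCorridor3.Sigma

end
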